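import Summits.RiemannHypothesis.RiemannHypothesis.Theorems.EtaLeadingQuarterSecondMomentEngineUniform
import HarnessLib

/-!
# The sharp eta vector at the zeros — engine IV: the truncation errors at the two lengths, by zone
(route EtaLeadingQuarter, item `EtaLeadingSecondMoment`, stmt-RiemannHypothesis-21791)

RH-free. For `M = 2L`, a height `4L < t ≤ M²` and `u = t/(2πL) = t/(πM)` (so the dual lengths of
`ζ_L` and `ζ_{2L}` are `u` and `u/2`), the truncation errors `Q_L(s)`, `Q_{2L}(s)` (`s = 1/2 + it`) of
`SecondMomentAFE.norm_altSum_le_of_zero` satisfy, for every `0 < η ≤ 1/2` and `L ≥ 32`,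

* `norm_QL_le`  — `‖Q_L‖  ≤ (124 + 2/η + 6 log(2L))/√L    + 1_{d ≤ η} · 64/√u`,
* `norm_Q2L_le` — `‖Q_2L‖ ≤ (124 + 4/η + 6 log(2L))/√(2L) + 1_{d ≤ η} · 64/√(u/2)`,

`d = |u − round u|` (off the transition zones the gap bounds of part I with gap `η`, resp. `η/2`;
inside them the uniform bound of part III; below the first stationary point (4.11.1)), and
`norm_E_le` adds them up: `√2 ‖Q_L‖ + ‖Q_2L‖ ≤ (400 + 12/η)(1 + log M)/√M + 1_{d ≤ η} · 400 √(M/t)`.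
Nothing here bears on the truth of RH.
-/

noncomputable section

open Real Finset Complex

set_option linter.dupNamespace false  -- the mandated namespace repeats `RiemannHypothesis`

namespace Summit.RiemannHypothesis.RiemannHypothesis.Theorems.EtaLeadingQuarter.Engine

open Literature.NumberTheory.LFunctions Literature.NumberTheory.LFunctions.VdC
  Literature.NumberTheory.LFunctions.AFE

/-! ## Distances to the nearest integer -/

/-- Off the zone: `|u − round u| > η` gives `η ≤ {u} ≤ 1 − η`. [folklore] -/
theorem fract_mem_of_round {u η : ℝ} (h : η < |u - round u|) :
    η ≤ Int.fract u ∧ Int.fract u ≤ 1 - η := by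
  rw [abs_sub_round_eq_min, lt_min_iff] at h
  exact ⟨h.1.le, by linarith [h.2]⟩

/-- Off the zone at `u`, the half `u/2` is off its zone with `η/2`. [folklore] -/
theorem half_off_zone {u η : ℝ} (h : η < |u - round u|) : η / 2 < |u / 2 - round (u / 2)| := by
  have h1 : |u - round u| ≤ |u - ((2 * round (u / 2) : ℤ) : ℝ)| := round_le u _
  have h2 : |u - ((2 * round (u / 2) : ℤ) : ℝ)| = 2 * |u / 2 - round (u / 2)| := by
    rw [show u - ((2 * round (u / 2) : ℤ) : ℝ) = 2 * (u / 2 - round (u / 2)) by push_cast; ring,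
      abs_mul, abs_two]
  linarith

/-! ## The shape of the height range -/

/-- For `L ≥ 32` and `4L < t ≤ (2L)²`, `u = t/(2πL)` satisfies `3/5 < u ≤ L`, `u + 2 ≤ 2L`,
`u/2 + 2 ≤ 2L`. [folklore] -/
theorem u_shape {L : ℕ} (hL : 32 ≤ L) {t : ℝ} (htlo : 4 * (L : ℝ) < t)
    (hthi : t ≤ ((2 * L : ℕ) : ℝ) ^ 2) :
    3 / 5 < t / (2 * π * L) ∧ t / (2 * π * L) ≤ L ∧ t / (2 * π * L) + 2 ≤ ((2 * L : ℕ) : ℝ) ∧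
      t / (2 * π * L) / 2 + 2 ≤ ((2 * L : ℕ) : ℝ) := by
  have hL0 : (0 : ℝ) < L := by exact_mod_cast (show 0 < L by omega)
  have hL32 : (32 : ℝ) ≤ L := by exact_mod_cast hL
  have hπ := Real.pi_gt_three
  have hπ4 := Real.pi_lt_d2
  have hden : 0 < 2 * π * (L : ℝ) := by positivity
  have h2L : ((2 * L : ℕ) : ℝ) = 2 * L := by push_cast; ring
  rw [h2L] at hthi ⊢
  refine ⟨?_, ?_, ?_, ?_⟩
  · rw [lt_div_iff₀ hden]; nlinarith
  · rw [div_le_iff₀ hden]; nlinarith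
  · have : t / (2 * π * L) ≤ 2 * L - 2 := by
      rw [div_le_iff₀ hden]; nlinarith
    linarith
  · have : t / (2 * π * L) ≤ 2 * L - 2 := by
      rw [div_le_iff₀ hden]; nlinarith
    linarith

/-! ## The truncation error at the length `L` -/

/-- **`Q_L` by zone.** For `L ≥ 32`, `4L < t ≤ (2L)²`, `0 < η ≤ 1/2`, `u = t/(2πL)`:
`‖Q_L(1/2+it)‖ ≤ (124 + 2/η + 6 log(2L))/√L + 1_{|u − round u| ≤ η} · 64/√u`. [folklore] -/
theorem norm_QL_le {L : ℕ} (hL : 32 ≤ L) {t η : ℝ} (htlo : 4 * (L : ℝ) < t)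
    (hthi : t ≤ ((2 * L : ℕ) : ℝ) ^ 2) (hη0 : 0 < η) (hη2 : η ≤ 1 / 2) (s : ℂ)
    (hs : s = 1 / 2 + t * I) :
    ‖riemannZeta s - ∑ n ∈ Finset.Icc 1 L, (n : ℂ) ^ (-s) + (L : ℂ) ^ (1 - s) / (1 - s)
        - afeCoeff s * ∑ n ∈ Finset.Icc 1 ⌊t / (2 * π * L)⌋₊, (n : ℂ) ^ (s - 1)‖ ≤
      (124 + 2 / η + 6 * Real.log ((2 * L : ℕ) : ℝ)) / Real.sqrt L +
        (if |t / (2 * π * L) - round (t / (2 * π * L))| ≤ η then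
          64 / Real.sqrt (t / (2 * π * L)) else 0) := by
  obtain ⟨hu35, huL, hu2, -⟩ := u_shape hL htlo hthi
  set u : ℝ := t / (2 * π * L) with hudef
  have hL1 : 1 ≤ L := by omega
  have hL16 : 16 ≤ L := by omega
  have hL0 : (0 : ℝ) < L := by exact_mod_cast (show 0 < L by omega)
  have ht : 0 < t := by linarith
  have hu0 : 0 < u := by linarith
  have hsL : 0 < Real.sqrt L := Real.sqrt_pos.2 hL0
  have h2L0 : (0 : ℝ) < ((2 * L : ℕ) : ℝ) := by positivity
  -- `log(u+2) ≤ log(2L)`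
  have hlog : Real.log (u + 2) ≤ Real.log ((2 * L : ℕ) : ℝ) := Real.log_le_log (by linarith) hu2
  have hlog0 : 0 ≤ Real.log (u + 2) := Real.log_nonneg (by linarith)
  have hind0 : 0 ≤ (if |u - round u| ≤ η then 64 / Real.sqrt u else 0) := by
    split_ifs <;> positivity
  -- the generic weakening
  have weak : ∀ c : ℝ, c ≤ 124 + 2 / η + 6 * Real.log ((2 * L : ℕ) : ℝ) →
      c / Real.sqrt L ≤ (124 + 2 / η + 6 * Real.log ((2 * L : ℕ) : ℝ)) / Real.sqrt L +
        (if |u - round u| ≤ η then 64 / Real.sqrt u else 0) := by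
    intro c hc
    have := div_le_div_of_nonneg_right hc hsL.le
    linarith
  have hη' : 0 ≤ 2 / η := by positivity
  rcases le_or_gt u (1 - η) with ha | ha
  · -- below the first stationary point
    exact (norm_Q_le_of_low ht hL1 hη0 (by linarith) ha s hs).trans (weak _ (by linarith))
  by_cases hzone : |u - round u| ≤ η
  · -- in the zone: the uniform bound
    rw [if_pos hzone]
    have h := norm_Q_le_uniform ht hL16 (by linarith) huL s hs
    have h1 : (110 + 6 * Real.log (u + 2)) / Real.sqrt L ≤
        (124 + 2 / η + 6 * Real.log ((2 * L : ℕ) : ℝ)) / Real.sqrt L :=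
      div_le_div_of_nonneg_right (by linarith) hsL.le
    linarith
  · -- off the zone: `u ≥ 1 + η` (as `|u − 1| ≥ |u − round u| > η` and `u > 1 − η`), gap bound
    rw [if_neg hzone]
    have hz : η < |u - round u| := lt_of_not_ge hzone
    have hu1 : 1 + η ≤ u := by
      have h1 : |u - round u| ≤ |u - ((1 : ℤ) : ℝ)| := round_le u 1
      rw [Int.cast_one] at h1
      by_contra hcon
      have : |u - 1| ≤ η := abs_le.2 ⟨by linarith, by linarith⟩
      linarith
    obtain ⟨hf1, hf2⟩ := fract_mem_of_round hz
    have h := norm_Q_le_of_gap ht hL1 hη0 (by linarith) hf1 hf2 s hs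
    refine h.trans ?_
    rw [add_zero]
    exact div_le_div_of_nonneg_right (by linarith) hsL.le

/-! ## The truncation error at the length `2L` -/

/-- **`Q_{2L}` by zone.** For `L ≥ 32`, `4L < t ≤ (2L)²`, `0 < η ≤ 1/2`, `u = t/(2πL)` (so the dual
length of `ζ_{2L}` is `u/2`):
`‖Q_{2L}(1/2+it)‖ ≤ (124 + 4/η + 6 log(2L))/√(2L) + 1_{|u − round u| ≤ η} · 64/√(u/2)`. [folklore] -/
theorem norm_Q2L_le {L : ℕ} (hL : 32 ≤ L) {t η : ℝ} (htlo : 4 * (L : ℝ) < t)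
    (hthi : t ≤ ((2 * L : ℕ) : ℝ) ^ 2) (hη0 : 0 < η) (hη2 : η ≤ 1 / 2) (s : ℂ)
    (hs : s = 1 / 2 + t * I) :
    ‖riemannZeta s - ∑ n ∈ Finset.Icc 1 (2 * L), (n : ℂ) ^ (-s) +
        ((2 * L : ℕ) : ℂ) ^ (1 - s) / (1 - s)
        - afeCoeff s * ∑ n ∈ Finset.Icc 1 ⌊t / (2 * π * ((2 * L : ℕ) : ℝ))⌋₊, (n : ℂ) ^ (s - 1)‖ ≤
      (124 + 4 / η + 6 * Real.log ((2 * L : ℕ) : ℝ)) / Real.sqrt ((2 * L : ℕ) : ℝ) +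
        (if |t / (2 * π * L) - round (t / (2 * π * L))| ≤ η then
          64 / Real.sqrt (t / (2 * π * L) / 2) else 0) := by
  obtain ⟨hu35, huL, -, hu22⟩ := u_shape hL htlo hthi
  have hL0 : (0 : ℝ) < L := by exact_mod_cast (show 0 < L by omega)
  have huu : t / (2 * π * ((2 * L : ℕ) : ℝ)) = t / (2 * π * L) / 2 := by
    push_cast; field_simp
  rw [huu]
  set u : ℝ := t / (2 * π * L) with hudef
  have h2L1 : 1 ≤ 2 * L := by omega
  have h2L16 : 16 ≤ 2 * L := by omega
  have ht : 0 < t := by linarith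
  have hu0 : 0 < u := by linarith
  have h2L0 : (0 : ℝ) < ((2 * L : ℕ) : ℝ) := by positivity
  have hsM : 0 < Real.sqrt ((2 * L : ℕ) : ℝ) := Real.sqrt_pos.2 h2L0
  have hlog : Real.log (u / 2 + 2) ≤ Real.log ((2 * L : ℕ) : ℝ) :=
    Real.log_le_log (by linarith) hu22
  have hlog0 : 0 ≤ Real.log (u / 2 + 2) := Real.log_nonneg (by linarith)
  have hind0 : 0 ≤ (if |u - round u| ≤ η then 64 / Real.sqrt (u / 2) else 0) := by
    split_ifs <;> positivity
  have weak : ∀ c : ℝ, c ≤ 124 + 4 / η + 6 * Real.log ((2 * L : ℕ) : ℝ) →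
      c / Real.sqrt ((2 * L : ℕ) : ℝ) ≤
        (124 + 4 / η + 6 * Real.log ((2 * L : ℕ) : ℝ)) / Real.sqrt ((2 * L : ℕ) : ℝ) +
        (if |u - round u| ≤ η then 64 / Real.sqrt (u / 2) else 0) := by
    intro c hc
    have := div_le_div_of_nonneg_right hc hsM.le
    linarith
  have hη' : 0 ≤ 4 / η := by positivity
  have hlogM : 0 ≤ Real.log ((2 * L : ℕ) : ℝ) := hlog0.trans hlog
  have hu2L : u / 2 ≤ ((2 * L : ℕ) : ℝ) := by push_cast; linarith
  -- the bounds of part I/III at the length `2L` are stated with `t/(2π(2L))`; rewrite it to `u/2`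
  have low : ∀ δ : ℝ, 0 < δ → δ ≤ 1 → u / 2 ≤ 1 - δ →
      ‖riemannZeta s - ∑ n ∈ Finset.Icc 1 (2 * L), (n : ℂ) ^ (-s) +
          ((2 * L : ℕ) : ℂ) ^ (1 - s) / (1 - s)
          - afeCoeff s * ∑ n ∈ Finset.Icc 1 ⌊u / 2⌋₊, (n : ℂ) ^ (s - 1)‖ ≤
        (3 + 2 / δ) / Real.sqrt ((2 * L : ℕ) : ℝ) := by
    intro δ hδ hδ1 hle
    have h := norm_Q_le_of_low ht h2L1 hδ hδ1 (by rw [huu]; exact hle) s hs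
    rw [huu] at h
    exact h
  rcases le_or_gt u (1 - η) with ha | ha
  · -- `u/2 ≤ 1/2`
    exact (low (1 / 2) (by norm_num) (by norm_num) (by linarith)).trans
      (weak _ (by rw [show (2 : ℝ) / (1 / 2) = 4 by norm_num]; linarith))
  rcases lt_or_ge u (1 + η) with hb | hb
  · -- `u/2 < 3/4`
    exact (low (1 / 4) (by norm_num) (by norm_num) (by linarith)).trans
      (weak _ (by rw [show (2 : ℝ) / (1 / 4) = 8 by norm_num]; linarith))
  by_cases hzone : |u - round u| ≤ η
  · -- in the zone: the uniform bound at `2L` (`u/2 ≥ 1/2`)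
    rw [if_pos hzone]
    have h := norm_Q_le_uniform ht h2L16 (by rw [huu]; linarith) (by rw [huu]; exact hu2L) s hs
    rw [huu] at h
    have h1 : (110 + 6 * Real.log (u / 2 + 2)) / Real.sqrt ((2 * L : ℕ) : ℝ) ≤
        (124 + 4 / η + 6 * Real.log ((2 * L : ℕ) : ℝ)) / Real.sqrt ((2 * L : ℕ) : ℝ) :=
      div_le_div_of_nonneg_right (by linarith) hsM.le
    linarith
  · rw [if_neg hzone]
    have hz : η < |u - round u| := lt_of_not_ge hzone
    rcases lt_or_ge (u / 2) 1 with hc | hc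
    · -- `u < 2`, and off the zone `u ≤ 2 − η`: (4.11.1) with gap `η/2`
      have hu2 : u ≤ 2 - η := by
        have h1 : |u - round u| ≤ |u - ((2 : ℤ) : ℝ)| := round_le u 2
        rw [Int.cast_ofNat] at h1
        by_contra hcon
        have : |u - 2| ≤ η := abs_le.2 ⟨by linarith, by linarith⟩
        linarith
      refine (low (η / 2) (by positivity) (by linarith) (by linarith)).trans ?_
      rw [add_zero]
      exact div_le_div_of_nonneg_right (by rw [div_div_eq_mul_div]; linarith) hsM.le
    · -- `u/2 ≥ 1`, off its zone with `η/2`: the gap bound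
      obtain ⟨hf1, hf2⟩ := fract_mem_of_round (half_off_zone hz)
      have h := norm_Q_le_of_gap ht h2L1 (δ := η / 2) (by positivity) (by rw [huu]; exact hc)
        (by rw [huu]; exact hf1) (by rw [huu]; exact hf2) s hs
      rw [huu] at h
      refine h.trans ?_
      rw [add_zero]
      exact div_le_div_of_nonneg_right (by rw [div_div_eq_mul_div]; linarith) hsM.le

/-! ## The two lengths together -/

/-- `√π ≤ 16/9` and `√2 ≤ 17/12`. [folklore] -/
theorem sqrt_pi_le : Real.sqrt π ≤ 16 / 9 ∧ Real.sqrt 2 ≤ 17 / 12 := by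
  constructor
  · rw [Real.sqrt_le_left (by norm_num)]; nlinarith [Real.pi_lt_d2]
  · rw [Real.sqrt_le_left (by norm_num)]; norm_num

/-- **The error of the engine, per zero height.** For `L ≥ 32`, `M = 2L`, `4L < t ≤ M²`,
`0 < η ≤ 1/2`, `u = t/(2πL)`, `s = 1/2 + it`:
`√2 ‖Q_L(s)‖ + ‖Q_{2L}(s)‖ ≤ (400 + 12/η)(1 + log M)/√M + 1_{|u − round u| ≤ η} · 400 √(M/t)`.
[folklore] -/
theorem norm_E_le {L : ℕ} (hL : 32 ≤ L) {t η : ℝ} (htlo : 4 * (L : ℝ) < t)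
    (hthi : t ≤ ((2 * L : ℕ) : ℝ) ^ 2) (hη0 : 0 < η) (hη2 : η ≤ 1 / 2) (s : ℂ)
    (hs : s = 1 / 2 + t * I) :
    Real.sqrt 2 * ‖riemannZeta s - ∑ n ∈ Finset.Icc 1 L, (n : ℂ) ^ (-s) + (L : ℂ) ^ (1 - s) / (1 - s)
        - afeCoeff s * ∑ n ∈ Finset.Icc 1 ⌊t / (2 * π * L)⌋₊, (n : ℂ) ^ (s - 1)‖ +
      ‖riemannZeta s - ∑ n ∈ Finset.Icc 1 (2 * L), (n : ℂ) ^ (-s) +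
        ((2 * L : ℕ) : ℂ) ^ (1 - s) / (1 - s)
        - afeCoeff s * ∑ n ∈ Finset.Icc 1 ⌊t / (2 * π * ((2 * L : ℕ) : ℝ))⌋₊, (n : ℂ) ^ (s - 1)‖ ≤
      (400 + 12 / η) * (1 + Real.log ((2 * L : ℕ) : ℝ)) / Real.sqrt ((2 * L : ℕ) : ℝ) +
        (if |t / (2 * π * L) - round (t / (2 * π * L))| ≤ η then
          400 * Real.sqrt (((2 * L : ℕ) : ℝ) / t) else 0) := by
  have hQL := norm_QL_le hL htlo hthi hη0 hη2 s hs
  have hQ2L := norm_Q2L_le hL htlo hthi hη0 hη2 s hs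
  obtain ⟨hu35, -, -, -⟩ := u_shape hL htlo hthi
  set u : ℝ := t / (2 * π * L) with hudef
  set A : ℝ := ‖riemannZeta s - ∑ n ∈ Finset.Icc 1 L, (n : ℂ) ^ (-s) + (L : ℂ) ^ (1 - s) / (1 - s)
        - afeCoeff s * ∑ n ∈ Finset.Icc 1 ⌊u⌋₊, (n : ℂ) ^ (s - 1)‖ with hA
  set B : ℝ := ‖riemannZeta s - ∑ n ∈ Finset.Icc 1 (2 * L), (n : ℂ) ^ (-s) +
        ((2 * L : ℕ) : ℂ) ^ (1 - s) / (1 - s)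
        - afeCoeff s * ∑ n ∈ Finset.Icc 1 ⌊t / (2 * π * ((2 * L : ℕ) : ℝ))⌋₊, (n : ℂ) ^ (s - 1)‖ with hB
  have hL0 : (0 : ℝ) < L := by exact_mod_cast (show 0 < L by omega)
  have ht : 0 < t := by linarith
  have hu0 : 0 < u := by linarith
  set M : ℝ := ((2 * L : ℕ) : ℝ) with hMdef
  have hM : M = 2 * L := by rw [hMdef]; push_cast; ring
  have hM0 : 0 < M := by rw [hM]; positivity
  have hsM : 0 < Real.sqrt M := Real.sqrt_pos.2 hM0
  have hlogM : 0 ≤ Real.log M := Real.log_nonneg (by rw [hM]; linarith [show (32 : ℝ) ≤ L by exact_mod_cast hL])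
  obtain ⟨hsπ, hs2⟩ := sqrt_pi_le
  -- `1/√L = √2/√M`
  have hsL : Real.sqrt L = Real.sqrt M / Real.sqrt 2 := by
    rw [hM, Real.sqrt_mul' _ hL0.le, mul_div_cancel_left₀ _ (Real.sqrt_ne_zero'.2 two_pos)]
  have hsqrt2 : Real.sqrt 2 * Real.sqrt 2 = 2 := Real.mul_self_sqrt (by norm_num)
  -- the `1/√X` parts
  have h1 : Real.sqrt 2 * ((124 + 2 / η + 6 * Real.log M) / Real.sqrt L) +
      (124 + 4 / η + 6 * Real.log M) / Real.sqrt M ≤ (400 + 12 / η) * (1 + Real.log M) / Real.sqrt M := by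
    rw [hsL]
    have e : Real.sqrt 2 * ((124 + 2 / η + 6 * Real.log M) / (Real.sqrt M / Real.sqrt 2)) +
        (124 + 4 / η + 6 * Real.log M) / Real.sqrt M =
        (372 + 8 / η + 18 * Real.log M) / Real.sqrt M := by
      have hsq2' : Real.sqrt 2 ^ 2 = 2 := Real.sq_sqrt (by norm_num)
      field_simp
      rw [hsq2']
      ring
    rw [e]
    apply div_le_div_of_nonneg_right _ hsM.le
    have hη' : 0 ≤ 1 / η := by positivity
    have hk : 0 ≤ 1 / η * Real.log M := mul_nonneg hη' hlogM
    have e2 : (400 + 12 / η) * (1 + Real.log M) =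
        400 + 12 * (1 / η) + 400 * Real.log M + 12 * (1 / η * Real.log M) := by ring
    have e3 : (372 : ℝ) + 8 / η + 18 * Real.log M = 372 + 8 * (1 / η) + 18 * Real.log M := by ring
    rw [e2, e3]
    linarith
  -- the in-zone parts: `1/√u = √π √(M/t)`, `1/√(u/2) = √2 √π √(M/t)`
  have hMt : 0 < M / t := by positivity
  have hu_eq : u = (M / t)⁻¹ / π := by
    rw [hudef, hM, inv_div]; field_simp
  have hsu : 1 / Real.sqrt u = Real.sqrt π * Real.sqrt (M / t) := by
    rw [hu_eq, Real.sqrt_div' _ Real.pi_pos.le, Real.sqrt_inv, one_div, inv_div,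
      div_eq_iff (inv_ne_zero (Real.sqrt_ne_zero'.2 hMt))]
    rw [mul_assoc, mul_inv_cancel₀ (Real.sqrt_ne_zero'.2 hMt), mul_one]
  have hsu2 : 1 / Real.sqrt (u / 2) = Real.sqrt 2 * (Real.sqrt π * Real.sqrt (M / t)) := by
    rw [← hsu, Real.sqrt_div' _ (by norm_num : (0 : ℝ) ≤ 2)]
    field_simp
  have h2 : Real.sqrt 2 * (64 / Real.sqrt u) + 64 / Real.sqrt (u / 2) ≤ 400 * Real.sqrt (M / t) := by
    rw [div_eq_mul_one_div 64 (Real.sqrt u), div_eq_mul_one_div 64 (Real.sqrt (u / 2)), hsu, hsu2]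
    have hMt' : 0 ≤ Real.sqrt (M / t) := Real.sqrt_nonneg _
    have hc : Real.sqrt 2 * 64 * Real.sqrt π + 64 * Real.sqrt 2 * Real.sqrt π ≤ 400 := by
      nlinarith [Real.sqrt_nonneg 2, Real.sqrt_nonneg π]
    nlinarith [mul_le_mul_of_nonneg_right hc hMt']
  by_cases hzone : |u - round u| ≤ η
  · rw [if_pos hzone] at hQL hQ2L ⊢
    have hA' := mul_le_mul_of_nonneg_left hQL (Real.sqrt_nonneg 2)
    rw [mul_add] at hA'
    linarith
  · rw [if_neg hzone] at hQL hQ2L ⊢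
    have hA' := mul_le_mul_of_nonneg_left hQL (Real.sqrt_nonneg 2)
    rw [add_zero] at hA' hQ2L
    linarith

end Summit.RiemannHypothesis.RiemannHypothesis.Theorems.EtaLeadingQuarter.Engine

end
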